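import Summits.HodgeConjecture.HodgeConjecture.Theorems.Ring2HypothesesDescent
import Summits.HodgeConjecture.HodgeConjecture.Theorems.Ring2HypothesesDescentHolds
import Summits.HodgeConjecture.HodgeConjecture.Theorems.Ring2HypothesesCMPivot
import Summits.HodgeConjecture.HodgeConjecture.Theorems.Ring2DeformCompactPencils
import Summits.HodgeConjecture.HodgeConjecture.Theorems.Ring2BindersAbelianSchemeVHCLocal
import Summits.HodgeConjecture.HodgeConjecture.Theorems.AnchorTransportVariationalHodgeQuasiProjective
import Literature.AlgebraicGeometry.Andre1996.HodgeClassesMotivatedAssembly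
import Literature.AlgebraicGeometry.Motives.AbelianFibresOfAbelianFibre
import HarnessLib

/-!
# Ring 2 — hypotheses layer, descent axis: row b05 `MotivatedImpliesAlgebraicAV` sits ABOVE the compact-pencil
# node, the printed-carrier form of row b02 and row b08 — granted André's Théorème 0.5 (deformation), NOT Théorème
# 0.6.2; and what `HC_CM` is worth on this axis (it re-derives Théorème 0.6.2 along the CM-anchored families)

HONEST FRAMING (page 1, verbatim the cell's standing line): **research route conditional on HC_CM; not a
corollary; Q11.4-sentence-2 already refuted in dim ≥ 3.** Nothing in this file proves a case of the Hodge
conjecture, nothing discharges the binder of record b05 `Ring2.Hypotheses.MotivatedImpliesAlgebraicAV` ("motivated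
classes on complex abelian varieties are algebraic", `Ring2HypothesesDescent`; OPEN, in the dictionary `≡ HC_AV`
modulo André's Théorème 0.6.2 = the named fact `Andre1996_hodgeClasses_abelianVariety_motivated`, table row c2 of
`BINDER-OWNERS.md`), and `HC_CM` — written BY NAME as `Theses.RankFourFaces.CMAbelianHodge`, never restated — is a
CONCLUSION in §4 and an explicit HYPOTHESIS (a binder) exactly in §5, where it is load-bearing. No definition, no new
named fact, no `sorry`; every Literature input is a PRE-EXISTING named fact of the tree, a hypothesis by name:
`HodgeTheory.Andre1996_deformation` (André 1996 Thm. 0.5, global-class form; row c24) everywhere;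
`Andre1996.andre1996_cmAnchoredPencil` / `andre1996_cmHodgeClasses_algebraicallyAnchoredPencils` (Lemme 6.3.1 /
Lemmes 6.3.2–6.3.3; rows c11 / c12) in §4 and (V9), through the deform seat's part IV `Ring2DeformCompactPencils`;
`Motives.catanese2002_abelianFibres_of_abelianFibre` (row c21) in (V5). This is the MOTIVATED TWIN of binder seat
ring2-b06's `Ring2HypothesesDescentAbsoluteVariational` (row b06 above rows b02 / b08 granted Deligne's Principle B):
the transport engine is Théorème 0.5 in place of Principle B, "algebraic ⟹ motivated" (the tree's THEOREM
`algebraicClasses_le_motivatedClasses_of_nonempty_hardLefschetzNFold_self` with `nonempty_hardLefschetzNFold_holds`) in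
place of Example 2.1 (a), and the chart transport is the tree's THEOREM `map_mem_motivatedClasses_iff_of_iso`. Seat
ring2-b03's junction (J11)–(J11″) (`Ring2BindersVariationalHodgeAbsolute`) placed the printed-carrier variational nodes
below the PARENT node `MotivatedImpliesAlgebraic` (all smooth projective varieties) granted Théorème 0.5; on
ABELIAN-fibred families the ROW b05 suffices, consumed on the target fibre only.

## What this file adds (cell `pub-hodge-ring2`, Hodge ladder stage 3, binder seat ring2-b05, row b05)

* §1 (V1) row b05 in CHART form (fact-free). §2 (V2)/(V3) **`MotivatedImpliesAlgebraicAV ⟹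
  Ring2.Deform.CompactAbelianPencilVHC`** granted Théorème 0.5 ONLY — per pencil (V2) with NO fibrewise rationality /
  Hodge-type hypothesis (motivation needs none). Before: `b05 ⟹[c2] HC_AV ⟹ CompactAbelianPencilVHC`.
* §3 (V4) PER INSTANCE on the printed (quasi-projective) carriers, granted Théorème 0.5: a global class algebraic on
  ONE fibre is algebraic on every ABELIAN fibre (anchor arbitrary, no Hodge condition) — row b02 on the printed
  carriers, target-wise (over affine bases ring2-b02's residual `AbelianTotalQuasiProjective[]` would give row b02
  itself by `Ring2.Binders.abelianSchemeVHC_of_affine`; not asserted — row b02 is reached residual-free through `HC_AV`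
  in (V6c)). (V5) **row b05 ⟹ row b08 `LocalVHCAtCM`** granted Théorème 0.5 and c21, with `U = S(ℂ)` and the CM
  hypothesis IDLE: the one `HC_CM`-load-bearing row of the dictionary is reached without `HC_CM` and without 0.6.2.
* §4 (V6) by composition with the deform seat's part IV (count once, theirs), granted Théorème 0.5 and Lemmes
  6.3.1–6.3.3: **`MotivatedImpliesAlgebraicAV ⟹ HC_CM`, `⟹ HC_AV`, `⟹ AbelianSchemeVHC`**, EXACTNESS
  **`MotivatedImpliesAlgebraicAV ↔ HC_AV ↔ CompactAbelianPencilVHC`** — a second, 0.6.2-free modulus for the dictionary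
  cell "b05 ≡ HC_AV modulo c2" (`HC_AV ⟹ b05` is the tree's DISCHARGED `motivatedImpliesAlgebraicAV_of_hc_av_holds`) —
  and (V6e) Théorème 0.6.2 itself (c2) as a CONSEQUENCE of row b05. Unsurprising in print: André's proof of 0.6.2 IS
  Théorème 0.5 + the §6.3 pencils + Prop. 2.1 (ii) (the literature seat's
  `Andre1996_hodgeClasses_abelianVariety_motivated_of_pencils`, with the extra named fact
  `Andre1996_motivatedClasses_pullback`); reading "motivé" as "algébrique" at the anchors (Remarque 2) makes the
  pull-back step the THEOREM `map_mem_algebraicClasses_of_abelianVariety`, and Prop. 2.1 (ii) drops out.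
* §5 (V7) WHAT `HC_CM` IS WORTH ON THE MOTIVATED AXIS — **`HC_CM ∧ CMAnchoredFamilies ⟹ [Théorème 0.6.2]`** granted
  Théorème 0.5: the named fact c2 DERIVED in the kernel from the binder `HC_CM`, row b07 `CMAnchoredFamilies` (CITE,
  `⟸` c8 by `Ring2.Deform.cmAnchoredFamilies_of_deligne1982`) and c24 — André's step a) of §6.3 run along Deligne's
  CM-anchored Mumford–Tate families, steps b), c) replaced by `HC_CM`. Here — and only here — `HC_CM` is
  LOAD-BEARING. (V8) the CM PIVOT WITH ROW b05 IN PLACE OF ROW b08: **`HC_CM ∧ CMAnchoredFamilies ∧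
  MotivatedImpliesAlgebraicAV ⟹ HC_AV`** modulo {c24}; (V9) the compact-pencil form
  **`HC_CM ∧ MotivatedImpliesAlgebraicAV ⟹ HC_AV`** modulo {c24, c11} (Lemme 6.3.1 in place of row b07).

## HONEST COLUMN (what the kernel theorems do NOT say)

(1) No node is discharged: `MotivatedImpliesAlgebraicAV`, `CompactAbelianPencilVHC`, `AbelianSchemeVHC`,
`LocalVHCAtCM`, `HC_AV`, `HC_CM` stay OPEN; the facts stay named facts (c2 is derived in (V6e)/(V7) only UNDER the
open row b05, resp. the open binder `HC_CM` and the CITE row b07); the numbers «10 · 0» do not move. (2) (V3)–(V6)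
relate statements each already `≡ HC_AV` modulo print; the gain is the MODULUS (Thm. 0.5, resp. Thm. 0.5 + Lemmes
6.3.1–6.3.3, in place of Thm. 0.6.2) and the typing of (V2)/(V4) (target fibre only; no Hodge-type hypothesis).
(3) Not claimed: `AbelianSchemeVHC` from row b05 and Théorème 0.5 alone (the row's families are section-free smooth
proper families with abelian fibres over arbitrary smooth irreducible bases; André's theorem is typed for projective
morphisms, and the tree does not know such total spaces to be quasi-projective over affine bases — ring2-b02's
residual); anything on non-abelian target fibres (the parent node's business, (J11)); the converse
`CompactAbelianPencilVHC ⟹ MotivatedImpliesAlgebraicAV` without Lemmes 6.3.1–6.3.3 (it passes through `HC_AV`).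
(4) `HC_CM` is an input in §5 only, and there it is dominated MODULO PRINT like everywhere on this axis (row b05
alone gives `HC_CM`: modulo c2 by the dictionary, modulo c12 + c24 by (V6a)); what `HC_CM` and row b07 buy in
(V7)/(V8) is exactly the removal of c2 (resp. of Lemmes 6.3.2–6.3.3) from the modulus — a statement about which
printed theorems the road uses, not independent evidence for `HC_AV`.

References (keys of `references.bib`): Andre1996Motifs (Thm. 0.5 p. 8; Thm. 0.6.2 p. 9; §2.1; §5.1; §6.3 Lemmes
6.3.1–6.3.3 and Remarque 2, pp. 31–33), Deligne1982HodgeCycles (Introduction p. 6; Prop. 6.1; Milne's 2003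
re-edition endnote 19), CharlesSchnell2014Notes (Conj. 11.3.1, remark after Thm. 11.3.8, Cor. 11.3.6, Thm. 11.5.11),
Milne2020HodgeClassesAV (Rem. 2–3), Abdulali1994FamiliesAV ((1.1), Lemma 6.2), Catanese2002DeformationTypes
(Thm. 4.1, 4.6), Grothendieck1966 (footnote 13), Hartshorne1977 (II Ex. 4.8–4.9), GortzWedhorn2023 (Thm. 27.291, the residual's print status).
-/

set_option linter.dupNamespace false

noncomputable section

open CategoryTheory AlgebraicGeometry
open Literature.AlgebraicGeometry Literature.AlgebraicGeometry.Motives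
open Literature.AlgebraicGeometry.HodgeTheory
open Literature.AlgebraicGeometry.Andre1996 (andre1996_cmAnchoredPencil
  andre1996_cmHodgeClasses_algebraicallyAnchoredPencils compactPencil_map_fiber_mem_motivatedClasses)

namespace Summit.HodgeConjecture.HodgeConjecture.Ring2.Hypotheses

/-! ## §1 Row b05 in chart form: motivated classes on a variety isomorphic to an abelian variety -/

/-- **(V1) Row b05 across an abelian chart (fact-free).** On a smooth projective `X` of dimension `n` with an
isomorphism `e : A'.X ≅ X` to (the variety underlying) an abelian variety, every motivated class is algebraic, granted
`MotivatedImpliesAlgebraicAV`: `e^* c` is motivated on `A'.X` (the tree's theorem `map_mem_motivatedClasses_iff_of_iso`),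
`dim A' = n` (`Motives.schemeDim_eq_holds`), row b05 applies on `A'`, and algebraicity moves back along `e`
(`mem_algebraicClasses_map_iff_of_iso`). [cite: Andre1996Motifs, §2.1 Déf. 1 and Prop. 2.1 (p. 14)] -/
theorem motivated_algebraic_of_iso_abelianVariety (h : MotivatedImpliesAlgebraicAV)
    {n : ℕ} {X : SchemeOver ℂ} (hX : IsSmoothProjective n X) {A' : AbelianVariety ℂ} (e : A'.X ≅ X)
    (p : ℕ) {c : complexBetti X (2 * p)} (hc : c ∈ motivatedClasses n X p) :
    c ∈ algebraicClasses X p := by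
  have hX' : IsSmoothProjective n A'.X := hX.of_iso e.symm
  have h₁ : complexBetti.map e.hom (2 * p) c ∈ motivatedClasses n A'.X p :=
    (map_mem_motivatedClasses_iff_of_iso hX hX' e c).2 hc
  have hdim : A'.dim = n := schemeDim_eq_holds hX'
  rw [← hdim] at h₁
  exact (mem_algebraicClasses_map_iff_of_iso e).1 (h A' p h₁)

/-- (V1′) Row b05 on an abelian FIBRE of a smooth projective family: a motivated class on a fibre `𝒳_s ≅ A'.X` is
algebraic ((V1) with the fibre's smooth-projectivity witness `IsSmoothProjectiveFamily.isSmoothProjective`).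
[cite: Andre1996Motifs, §2.1 Déf. 1 and Prop. 2.1 (p. 14)] -/
theorem motivated_algebraic_of_abelian_fiber (h : MotivatedImpliesAlgebraicAV)
    {n : ℕ} {𝒳 S : SchemeOver ℂ} {f : 𝒳 ⟶ S} (hf : IsSmoothProjectiveFamily f n) {s : ComplexPoints S}
    (hab : ∃ A' : AbelianVariety ℂ, Nonempty (A'.X ≅ fiberOver f s)) (p : ℕ)
    {c : complexBetti (fiberOver f s) (2 * p)} (hc : c ∈ motivatedClasses n (fiberOver f s) p) :
    c ∈ algebraicClasses (fiberOver f s) p := by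
  obtain ⟨A', ⟨e⟩⟩ := hab
  exact motivated_algebraic_of_iso_abelianVariety h (hf.isSmoothProjective s) e p hc

/-! ## §2 Row b05 ⟹ the compact-pencil node: Théorème 0.5 along compact pencils of abelian varieties -/

/-- **(V2) Per compact pencil: transport of algebraicity, granted Théorème 0.5 and row b05 — no Hodge-type
hypothesis.** For a compact pencil of abelian varieties `f : 𝒳 ⟶ S` of relative dimension `d` (André's «pinceau
compact», §6.3 footnote (2): `Motives.IsCompactAbelianPencil`) and a global class `W ∈ H²ᵖ(𝒳(ℂ); ℂ)` algebraic on ONE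
fibre `𝒳_{s₀}`: `W|_{𝒳_s}` is algebraic for every `s`. André's p. 33 with "motivé" read back into "algébrique" at the
two ends: algebraic ⟹ motivated at `s₀` (`A ⊆ A_mot`, hard Lefschetz of the fibre), motivated at `s` ("le théorème 0.5
appliqué au cas particulier d'un pinceau compact": the literature seat's `Andre1996.compactPencil_map_fiber_mem_motivatedClasses`,
its side conditions tree theorems), algebraic at `s` by (V1′). Neither rationality nor the Hodge type of any
restriction is assumed. [cite: Andre1996Motifs, Thm. 0.5 (p. 8) and §6.3 (p. 33)] [cite: Milne2020HodgeClassesAV, Rem. 3] -/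
theorem compactPencil_map_fiberι_mem_algebraicClasses_of_motivatedImpliesAlgebraicAV_of_deformation
    (hD : Andre1996_deformation) (h : MotivatedImpliesAlgebraicAV)
    {d : ℕ} {𝒳 S : SchemeOver ℂ} {f : 𝒳 ⟶ S} (hf : IsCompactAbelianPencil f d) (p : ℕ)
    (W : complexBetti 𝒳 (2 * p)) {s₀ : ComplexPoints S}
    (h₀ : complexBetti.map (fiberι f s₀) (2 * p) W ∈ algebraicClasses (fiberOver f s₀) p)
    (s : ComplexPoints S) :
    complexBetti.map (fiberι f s) (2 * p) W ∈ algebraicClasses (fiberOver f s) p := by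
  -- algebraic ⟹ motivated on the anchor fibre
  have h₀' : complexBetti.map (fiberι f s₀) (2 * p) W ∈ motivatedClasses d (fiberOver f s₀) p :=
    algebraicClasses_le_motivatedClasses_of_nonempty_hardLefschetzNFold_self
      (hf.isSmoothProjectiveFamily.isSmoothProjective s₀) (nonempty_hardLefschetzNFold_holds _ _) p h₀
  -- Théorème 0.5 along the pencil, then row b05 on the abelian fibre `𝒳_s`
  exact motivated_algebraic_of_abelian_fiber h hf.isSmoothProjectiveFamily (hf.exists_abelianVariety_fiber s) p
    (compactPencil_map_fiber_mem_motivatedClasses hD hf p W s₀ h₀' s)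

/-- **(V3) `MotivatedImpliesAlgebraicAV ⟹ CompactAbelianPencilVHC` (row b05 ⟹ the deform seat's compact-pencil node,
`Abdulali1994.InvariantCyclesHoldFor` on every compact pencil), granted Théorème 0.5 ONLY** — NOT Théorème 0.6.2: (V2),
the node's fibrewise Hodge hypothesis being idle. Compare the existing roads `b05 ⟹[c2] HC_AV ⟹ CompactAbelianPencilVHC`
(`hc_av_of_andre_of_motivatedImpliesAlgebraicAV`, `Ring2.Deform.compactAbelianPencilVHC_of_HC_AV`) and, from the PARENT
node, `MotivatedImpliesAlgebraic ⟹[c24] VariationalHodgeQP ⟹ CompactAbelianPencilVHC` ((J11′),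
`compactAbelianPencilVHC_of_variationalHodgeQP`). [cite: Andre1996Motifs, Thm. 0.5 (p. 8) and §6.3 Remarque 2 (p. 33)]
[cite: Abdulali1994FamiliesAV, (1.1) (p. 1122)] -/
theorem compactAbelianPencilVHC_of_motivatedImpliesAlgebraicAV_of_deformation
    (hD : Andre1996_deformation) (h : MotivatedImpliesAlgebraicAV) : Ring2.Deform.CompactAbelianPencilVHC :=
  fun _ _ _ _ hf p W _ h₀ s => by
    obtain ⟨s₀, hs₀⟩ := h₀
    exact compactPencil_map_fiberι_mem_algebraicClasses_of_motivatedImpliesAlgebraicAV_of_deformation hD h hf p W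
      hs₀ s

/-! ## §3 Row b05 ⟹ row b02 on the printed carriers (target-wise) and row b08: Théorème 0.5 along quasi-projective families -/

/-- **(V4) Per instance on the printed (quasi-projective) carriers: transport of algebraicity onto an ABELIAN target
fibre, granted Théorème 0.5 and row b05 — no Hodge-type hypothesis.** For `f : 𝒳 ⟶ S` smooth projective of relative
dimension `n`, `𝒳` and `S` quasi-projective, `S` smooth irreducible (the carriers of Charles–Schnell Conj. 11.3.1 and
of rows b07 / b08), a global class algebraic on ONE fibre `𝒳_{s₀}` is algebraic on every fibre `𝒳_s` isomorphic to
(the variety underlying) an abelian variety: `f` is projective in Hartshorne's sense (`𝒳` quasi-projective, `f`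
proper: `Theorems.exists_isClosedImmersion_of_isSmoothProjectiveFamily`), `S` is reduced, connected, locally of finite
type and quasi-compact, so Théorème 0.5 carries "motivated" (⟸ algebraic) from `s₀` to `s`, and (V1′) finishes. No
other fibre need be abelian. [cite: Andre1996Motifs, Thm. 0.5 (p. 8) and §5.1 (p. 25)]
[cite: CharlesSchnell2014Notes, Conj. 11.3.1 and remark after Thm. 11.3.8] [cite: Hartshorne1977, Ch. II Ex. 4.8–4.9] -/
theorem map_fiberι_mem_algebraicClasses_of_abelian_target_of_deformation
    (hD : Andre1996_deformation) (h : MotivatedImpliesAlgebraicAV)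
    ⦃n : ℕ⦄ ⦃𝒳 S : SchemeOver ℂ⦄ (f : 𝒳 ⟶ S) (hf : IsSmoothProjectiveFamily f n)
    (h𝒳 : IsQuasiProjectiveOver 𝒳) (hS : IsQuasiProjectiveOver S) (hirr : IrreducibleSpace S.left)
    (hsm : AlgebraicGeometry.Smooth S.hom) (p : ℕ) (W : complexBetti 𝒳 (2 * p)) {s₀ : ComplexPoints S}
    (halg : complexBetti.map (fiberι f s₀) (2 * p) W ∈ algebraicClasses (fiberOver f s₀) p)
    (s : ComplexPoints S) (hab : ∃ A' : AbelianVariety ℂ, Nonempty (A'.X ≅ fiberOver f s)) :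
    complexBetti.map (fiberι f s) (2 * p) W ∈ algebraicClasses (fiberOver f s) p := by
  haveI := hirr
  haveI := hsm
  have hred : IsReduced S.left := isReduced_of_smooth_over_field S.hom
  have hft : LocallyOfFiniteType S.hom := hS.locallyOfFiniteType
  have hqc : QuasiCompact S.hom := hS.isVarietyPair_ofScheme.quasiCompact
  -- algebraic ⟹ motivated on the anchor fibre
  have h₀ : complexBetti.map (fiberι f s₀) (2 * p) W ∈ motivatedClasses n (fiberOver f s₀) p :=
    algebraicClasses_le_motivatedClasses_of_nonempty_hardLefschetzNFold_self (hf.isSmoothProjective s₀)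
      (nonempty_hardLefschetzNFold_holds _ _) p halg
  -- Théorème 0.5 along `f` (projective in Hartshorne's sense), then row b05 on the abelian fibre `𝒳_s`
  exact motivated_algebraic_of_abelian_fiber h hf hab p
    (hD f hf (Theorems.exists_isClosedImmersion_of_isSmoothProjectiveFamily hf h𝒳) hred inferInstance hft hqc p W
      s₀ h₀ s)

/-- **(V5) `MotivatedImpliesAlgebraicAV ⟹ LocalVHCAtCM` (row b05 ⟹ row b08), granted Théorème 0.5 and Catanese's
theorem (c21) — no `HC_CM`, no Théorème 0.6.2.** In the row's own typing (`𝒳`, `S` quasi-projective, `S` smooth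
irreducible, a CM abelian fibre `A₀ ≅ 𝒳_{s₀}` on which the global class `G` is ALGEBRAIC) the conclusion holds with
`U = S(ℂ)`: the anchor is moved to `𝒳_{s₀}` along the chart, every fibre is an abelian variety (c21; relative
dimension `dim A₀ = m` by `Ring2.Binders.dim_eq_of_iso_fiberOver`), and (V4) applies at every `t`. The CM hypothesis
AND the fibrewise Hodge hypothesis are IDLE on this road; in the dictionary it is `HC_CM` that makes the CM fibre an
algebraic anchor — here algebraicity at `A₀` is the row's hypothesis, as filed.
[cite: CharlesSchnell2014Notes, Conj. 11.3.1] [cite: Andre1996Motifs, Thm. 0.5 (p. 8)]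
[cite: Catanese2002DeformationTypes, §4 Thm. 4.1 and Thm. 4.6] [cite: Deligne1982HodgeCycles, Prop. 6.1] -/
theorem localVHCAtCM_of_motivatedImpliesAlgebraicAV_of_deformation_of_catanese
    (hD : Andre1996_deformation) (hC : catanese2002_abelianFibres_of_abelianFibre)
    (h : MotivatedImpliesAlgebraicAV) : LocalVHCAtCM := by
  intro S 𝒳 f m p G s₀ A₀ e₀ h𝒳 hS hsm hirr hf hA₀ _ halg _
  obtain ⟨i, hi⟩ := hA₀
  haveI := hirr
  -- the anchor `A₀ ≅ 𝒳_{s₀}`: algebraic on THE fibre `𝒳_{s₀}`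
  have he₀ : complexBetti.map e₀ (2 * p) G =
      complexBetti.map i.hom (2 * p) (complexBetti.map (fiberι f s₀) (2 * p) G) := by
    rw [hi, complexBetti.map_comp]
    rfl
  rw [he₀] at halg
  have halg₀ : complexBetti.map (fiberι f s₀) (2 * p) G ∈ algebraicClasses (fiberOver f s₀) p :=
    (mem_algebraicClasses_map_iff_of_iso i).1 halg
  -- every fibre is an abelian variety (Catanese), the family having relative dimension `dim A₀ = m`
  have hdim : A₀.dim = m := Ring2.Binders.dim_eq_of_iso_fiberOver hf i
  have hfam : IsSmoothProjectiveFamily f A₀.dim := hdim ▸ hf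
  refine ⟨Set.univ, isOpen_univ, Set.mem_univ _, fun t _ => ?_⟩
  obtain ⟨B, -, hBt⟩ := hC f A₀ h𝒳 hS hirr hsm hfam ⟨s₀, ⟨i⟩⟩ t
  exact map_fiberι_mem_algebraicClasses_of_abelian_target_of_deformation hD h f hf h𝒳 hS hirr hsm p G halg₀ t
    ⟨B, hBt⟩

/-! ## §4 Consequences by composition (count once): `HC_CM`, `HC_AV`, row b02 as CONCLUSIONS of row b05 on a
0.6.2-free road; exactness; Théorème 0.6.2 as a consequence -/

/-- **(V6a) `MotivatedImpliesAlgebraicAV ⟹ HC_CM`** granted Théorème 0.5 and André 1996 Lemmes 6.3.2–6.3.3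
(`andre1996_cmHodgeClasses_algebraicallyAnchoredPencils`): (V3) and the deform seat's (D′)
`Ring2.Deform.HC_CM_of_andre1996_of_compactAbelianPencilVHC`. `HC_CM` is a CONCLUSION on this road, never an input;
compare the dictionary's `hc_cm_of_andre_of_motivatedImpliesAlgebraicAV` (modulo Théorème 0.6.2 instead).
[cite: Andre1996Motifs, Thm. 0.5, Lemmes 6.3.2–6.3.3 and Remarque 2 (pp. 8, 32–33)] -/
theorem hc_cm_of_motivatedImpliesAlgebraicAV_of_deformation_of_andre1996
    (hD : Andre1996_deformation) (h₂₂ : andre1996_cmHodgeClasses_algebraicallyAnchoredPencils)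
    (h : MotivatedImpliesAlgebraicAV) : Theses.RankFourFaces.CMAbelianHodge :=
  Ring2.Deform.HC_CM_of_andre1996_of_compactAbelianPencilVHC h₂₂
    (compactAbelianPencilVHC_of_motivatedImpliesAlgebraicAV_of_deformation hD h)

/-- **(V6b) `MotivatedImpliesAlgebraicAV ⟹ HC_AV`** granted Théorème 0.5 and André 1996 Lemmes 6.3.1–6.3.3
(`andre1996_cmAnchoredPencil`, `andre1996_cmHodgeClasses_algebraicallyAnchoredPencils`): (V3) and the deform seat's
(M′) `Ring2.Deform.HC_AV_of_andre1996_of_compactAbelianPencilVHC`. Compare the dictionary's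
`hc_av_of_andre_of_motivatedImpliesAlgebraicAV` (modulo Théorème 0.6.2): André's proof of 0.6.2 run with "algebraic" in
place of "motivated" at the anchors (Remarque 2), so that Prop. 2.1 (ii) is not needed.
[cite: Andre1996Motifs, Thm. 0.5 and §6.3 (pp. 8, 31–33)] [cite: Milne2020HodgeClassesAV, Rem. 2–3] -/
theorem hc_av_of_motivatedImpliesAlgebraicAV_of_deformation_of_andre1996
    (hD : Andre1996_deformation) (h₂₁ : andre1996_cmAnchoredPencil)
    (h₂₂ : andre1996_cmHodgeClasses_algebraicallyAnchoredPencils) (h : MotivatedImpliesAlgebraicAV) :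
    Theses.PadicSemiregularLift.HodgeAbelianVarieties :=
  Ring2.Deform.HC_AV_of_andre1996_of_compactAbelianPencilVHC h₂₁ h₂₂
    (compactAbelianPencilVHC_of_motivatedImpliesAlgebraicAV_of_deformation hD h)

/-- **(V6c) `MotivatedImpliesAlgebraicAV ⟹ AbelianSchemeVHC` (row b05 ⟹ row b02 over ALL smooth irreducible bases,
residual-free)** granted Théorème 0.5 and Lemmes 6.3.1–6.3.3: through `HC_AV` ((V6b) and the on-path
`abelianSchemeVHC_of_hc_av`). [cite: Andre1996Motifs, §6.3 Remarque 2 (p. 33)] [cite: CharlesSchnell2014Notes, Cor. 11.3.6] -/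
theorem abelianSchemeVHC_of_motivatedImpliesAlgebraicAV_of_deformation_of_andre1996
    (hD : Andre1996_deformation) (h₂₁ : andre1996_cmAnchoredPencil)
    (h₂₂ : andre1996_cmHodgeClasses_algebraicallyAnchoredPencils) (h : MotivatedImpliesAlgebraicAV) :
    AbelianSchemeVHC :=
  abelianSchemeVHC_of_hc_av (hc_av_of_motivatedImpliesAlgebraicAV_of_deformation_of_andre1996 hD h₂₁ h₂₂ h)

/-- **(V6d) EXACTNESS, 0.6.2-free: `HC_AV ↔ MotivatedImpliesAlgebraicAV`** granted Théorème 0.5 and Lemmes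
6.3.1–6.3.3 (`⟸` is (V6b); `⟹` is the tree's DISCHARGED `motivatedImpliesAlgebraicAV_of_hc_av_holds`, André §2.5 c)
proved). A second modulus for the dictionary cell "row b05 ≡ `HC_AV`" (`hc_av_iff_motivatedImpliesAlgebraicAV_holds`,
Théorème 0.6.2). [cite: Andre1996Motifs, Thm. 0.6.2 (p. 9), §2.5 c) and §6.3 Remarque 2 (p. 33)] -/
theorem hc_av_iff_motivatedImpliesAlgebraicAV_of_deformation_of_andre1996
    (hD : Andre1996_deformation) (h₂₁ : andre1996_cmAnchoredPencil)
    (h₂₂ : andre1996_cmHodgeClasses_algebraicallyAnchoredPencils) :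
    Theses.PadicSemiregularLift.HodgeAbelianVarieties ↔ MotivatedImpliesAlgebraicAV :=
  ⟨motivatedImpliesAlgebraicAV_of_hc_av_holds,
    hc_av_of_motivatedImpliesAlgebraicAV_of_deformation_of_andre1996 hD h₂₁ h₂₂⟩

/-- **(V6d′) EXACTNESS between row b05 and the compact-pencil node: `MotivatedImpliesAlgebraicAV ↔
CompactAbelianPencilVHC`** granted Théorème 0.5 and Lemmes 6.3.1–6.3.3: `⟹` is (V3) (Théorème 0.5 alone); `⟸` passes
through `HC_AV` (the deform seat's (M′), then the discharged on-path lemma); likewise for row b02 via (V6c).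
[cite: Andre1996Motifs, §6.3 Remarque 2 (p. 33)] [cite: CharlesSchnell2014Notes, Cor. 11.3.6] -/
theorem motivatedImpliesAlgebraicAV_iff_compactAbelianPencilVHC_of_deformation_of_andre1996
    (hD : Andre1996_deformation) (h₂₁ : andre1996_cmAnchoredPencil)
    (h₂₂ : andre1996_cmHodgeClasses_algebraicallyAnchoredPencils) :
    MotivatedImpliesAlgebraicAV ↔ Ring2.Deform.CompactAbelianPencilVHC :=
  ⟨compactAbelianPencilVHC_of_motivatedImpliesAlgebraicAV_of_deformation hD, fun hV =>
    motivatedImpliesAlgebraicAV_of_hc_av_holds (Ring2.Deform.HC_AV_of_andre1996_of_compactAbelianPencilVHC h₂₁ h₂₂ hV)⟩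

/-- **(V6e) Théorème 0.6.2 as a CONSEQUENCE of row b05 on this road**: granted Théorème 0.5 and Lemmes 6.3.1–6.3.3,
`MotivatedImpliesAlgebraicAV ⟹` the named fact c2 `Andre1996_hodgeClasses_abelianVariety_motivated` (every Hodge
class on a complex abelian variety is motivated): by (V6b) it is algebraic, hence motivated (`A ⊆ A_mot`). NOT a
discharge of c2 (the open row b05 is an input); compare the literature seat's open-input-free assembly
`Andre1996.Andre1996_hodgeClasses_abelianVariety_motivated_of_pencils` (c2 from c24, c11, c12 AND Prop. 2.1 (ii)).
[cite: Andre1996Motifs, Thm. 0.6.2 (p. 9) and §6.3 (p. 33)] -/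
theorem hodgeClasses_abelianVariety_motivated_of_motivatedImpliesAlgebraicAV_of_deformation_of_andre1996
    (hD : Andre1996_deformation) (h₂₁ : andre1996_cmAnchoredPencil)
    (h₂₂ : andre1996_cmHodgeClasses_algebraicallyAnchoredPencils) (h : MotivatedImpliesAlgebraicAV) :
    Andre1996_hodgeClasses_abelianVariety_motivated := by
  intro A hA p c hc hpp
  exact algebraicClasses_le_motivatedClasses_of_nonempty_hardLefschetzNFold_self hA
    (nonempty_hardLefschetzNFold_holds _ _) p
    ((hc_av_of_motivatedImpliesAlgebraicAV_of_deformation_of_andre1996 hD h₂₁ h₂₂ h A).2 p c hc hpp)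

/-! ## §5 What `HC_CM` is worth on the motivated axis: Théorème 0.6.2 from `HC_CM`, the CM-anchored Mumford–Tate
families and Théorème 0.5 — and the CM pivot with row b05 in place of row b08 -/

/-- **(V7) `HC_CM ∧ CMAnchoredFamilies ⟹` André's Théorème 0.6.2 (the named fact c2
`Andre1996_hodgeClasses_abelianVariety_motivated`: every Hodge class on every complex abelian variety is motivated),
granted Théorème 0.5.** André's step a) of §6.3 ("réduction au cas d'une variété abélienne de type CM") run along
Deligne's CM-anchored Mumford–Tate families (row b07 `CMAnchoredFamilies`, CITE: `⟸` c8 by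
`Ring2.Deform.cmAnchoredFamilies_of_deligne1982`) with steps b), c) (André 1992 = Lemme 6.3.2 and the Weil-class
pencils of Lemme 6.3.3) REPLACED by `HC_CM`: a rational `(p,p)` class `c` on `A` is `e^* G` with `G` on a
quasi-projective family through `A ≅ 𝒳_t` and a CM fibre `A₀ ≅ 𝒳_{s₀}`; `G|_{A₀}` is rational `(p,p)`, hence
ALGEBRAIC by `HC_CM` (eigenvalue typing via the tree's bridge `CMPivot.hodgeCM_of_cmAbelianHodge`), hence motivated on
`𝒳_{s₀}` (`A ⊆ A_mot`), hence `G|_{𝒳_t}` is motivated (Théorème 0.5 as in (V4)), hence so is `c = e^* G` on `A`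
(`map_mem_motivatedClasses_iff_of_iso`). `HC_CM` — BY NAME `Theses.RankFourFaces.CMAbelianHodge`, a binder — is
LOAD-BEARING here: it supplies the CM step. NOT a discharge of c2 (two open/CITE inputs).
[cite: Andre1996Motifs, Thm. 0.5 (p. 8), Thm. 0.6.2 (p. 9) and §6.3 a) (pp. 31–33)]
[cite: Deligne1982HodgeCycles, Introduction p. 6 and Prop. 6.1] [cite: CharlesSchnell2014Notes, Thm. 11.5.11] -/
theorem hodgeClasses_abelianVariety_motivated_of_hc_cm_of_cmAnchoredFamilies_of_deformation
    (hCM : Theses.RankFourFaces.CMAbelianHodge) (hMT : CMAnchoredFamilies) (hD : Andre1996_deformation) :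
    Andre1996_hodgeClasses_abelianVariety_motivated := by
  intro A hA p c hc hpp
  obtain ⟨S, 𝒳, f, G, t, s₀, e, A₀, e₀, h𝒳, hS, hsm, hirr, hf, ⟨i, hi⟩, ⟨i₀, hi₀⟩, hA₀, hGc, hG⟩ :=
    hMT A p c hc hpp
  haveI := hirr
  haveI := hsm
  -- the CM anchor: `G|_{A₀}` is rational `(p,p)`, hence algebraic by `HC_CM`, read on THE fibre `𝒳_{s₀}`
  have hG₀ := hG A₀ e₀ s₀ ⟨i₀, hi₀⟩
  have he₀ : complexBetti.map e₀ (2 * p) G =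
      complexBetti.map i₀.hom (2 * p) (complexBetti.map (fiberι f s₀) (2 * p) G) := by
    rw [hi₀, complexBetti.map_comp]
    rfl
  rw [he₀] at hG₀
  have halgA₀ : complexBetti.map i₀.hom (2 * p) (complexBetti.map (fiberι f s₀) (2 * p) G) ∈
      algebraicClasses A₀.X p :=
    (Theorems.HodgeAbelianVarieties.CMPivot.hodgeCM_of_cmAbelianHodge hCM A₀ hA₀).2 p _ hG₀.1 hG₀.2
  have halg₀ : complexBetti.map (fiberι f s₀) (2 * p) G ∈ algebraicClasses (fiberOver f s₀) p :=
    (mem_algebraicClasses_map_iff_of_iso i₀).1 halgA₀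
  -- algebraic ⟹ motivated on `𝒳_{s₀}`; Théorème 0.5 along the family: `G|_{𝒳_t}` is motivated
  have hmot₀ : complexBetti.map (fiberι f s₀) (2 * p) G ∈ motivatedClasses A.dim (fiberOver f s₀) p :=
    algebraicClasses_le_motivatedClasses_of_nonempty_hardLefschetzNFold_self (hf.isSmoothProjective s₀)
      (nonempty_hardLefschetzNFold_holds _ _) p halg₀
  have hS' : IsQuasiProjectiveOver S := hS
  have h𝒳' : IsQuasiProjectiveOver 𝒳 := h𝒳
  have hred : IsReduced S.left := isReduced_of_smooth_over_field S.hom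
  have hft : LocallyOfFiniteType S.hom := hS'.locallyOfFiniteType
  have hqc : QuasiCompact S.hom := hS'.isVarietyPair_ofScheme.quasiCompact
  have hmot : complexBetti.map (fiberι f t) (2 * p) G ∈ motivatedClasses A.dim (fiberOver f t) p :=
    hD f hf (Theorems.exists_isClosedImmersion_of_isSmoothProjectiveFamily hf h𝒳') hred inferInstance hft hqc p G
      s₀ hmot₀ t
  -- move it to `A` along the chart `i : A.X ≅ 𝒳_t`
  have he : c = complexBetti.map i.hom (2 * p) (complexBetti.map (fiberι f t) (2 * p) G) := by
    rw [← hGc, hi, complexBetti.map_comp]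
    rfl
  rw [he]
  exact (map_mem_motivatedClasses_iff_of_iso (hf.isSmoothProjective t) hA i _).2 hmot

/-- **(V8) The CM pivot with row b05 in place of row b08: `HC_CM ∧ CMAnchoredFamilies ∧ MotivatedImpliesAlgebraicAV
⟹ HC_AV`, granted Théorème 0.5**: (V7) gives Théorème 0.6.2, and the dictionary's
`hc_av_of_andre_of_motivatedImpliesAlgebraicAV` finishes. Compare `hc_av_of_hc_cm_of_cmAnchoredFamilies_of_localVHCAtCM`
(third input `LocalVHCAtCM`; with (V5), modulo {c24, c21}) and `hc_av_of_andre_of_motivatedImpliesAlgebraicAV` (row b05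
alone, modulo c2): `HC_CM` and row b07 replace c2 by c24, nothing more (honest column (4)).
[cite: Deligne1982HodgeCycles, Introduction p. 6 and Prop. 6.1] [cite: Andre1996Motifs, Thm. 0.5 and Thm. 0.6.2 (pp. 8–9)] -/
theorem hc_av_of_hc_cm_of_cmAnchoredFamilies_of_motivatedImpliesAlgebraicAV_of_deformation
    (hCM : Theses.RankFourFaces.CMAbelianHodge) (hMT : CMAnchoredFamilies) (hD : Andre1996_deformation)
    (h : MotivatedImpliesAlgebraicAV) : Theses.PadicSemiregularLift.HodgeAbelianVarieties :=
  hc_av_of_andre_of_motivatedImpliesAlgebraicAV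
    (hodgeClasses_abelianVariety_motivated_of_hc_cm_of_cmAnchoredFamilies_of_deformation hCM hMT hD) h

/-- **(V9) The compact-pencil form, `HC_CM` load-bearing: `HC_CM ∧ MotivatedImpliesAlgebraicAV ⟹ HC_AV` granted
Théorème 0.5 and Lemme 6.3.1 ONLY** (André's pencil in place of row b07; Lemmes 6.3.2–6.3.3 replaced by `HC_CM`):
(V3) and the deform seat's row V′ `Ring2.Deform.HC_AV_of_andre1996_of_HC_CM_of_compactAbelianPencilVHC`.
[cite: Andre1996Motifs, Thm. 0.5, Lemme 6.3.1 and §6.3 a) (pp. 8, 31–33)] [cite: Abdulali1994FamiliesAV, Lemma 6.2 (p. 1131)] -/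
theorem hc_av_of_hc_cm_of_motivatedImpliesAlgebraicAV_of_deformation_of_andre1996
    (hCM : Theses.RankFourFaces.CMAbelianHodge) (hD : Andre1996_deformation) (h₂₁ : andre1996_cmAnchoredPencil)
    (h : MotivatedImpliesAlgebraicAV) : Theses.PadicSemiregularLift.HodgeAbelianVarieties :=
  Ring2.Deform.HC_AV_of_andre1996_of_HC_CM_of_compactAbelianPencilVHC h₂₁ hCM
    (compactAbelianPencilVHC_of_motivatedImpliesAlgebraicAV_of_deformation hD h)

/-! ## Audit: nothing is decided here

Every theorem has among its hypotheses the OPEN row `MotivatedImpliesAlgebraicAV` and/or the OPEN binder `HC_CM`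
(`Theses.RankFourFaces.CMAbelianHodge`, §5 only) and/or the CITE row `CMAnchoredFamilies` (or, in the `iff`s,
concludes an equivalence between open statements), next to printed theorems that are hypotheses in Lean by name
(`Andre1996_deformation` everywhere; `andre1996_cmAnchoredPencil`, `andre1996_cmHodgeClasses_algebraicallyAnchoredPencils`,
`catanese2002_abelianFibres_of_abelianFibre` where stated). Axiom closures: the three standard axioms. -/

#print axioms Summit.HodgeConjecture.HodgeConjecture.Ring2.Hypotheses.compactAbelianPencilVHC_of_motivatedImpliesAlgebraicAV_of_deformation
#print axioms Summit.HodgeConjecture.HodgeConjecture.Ring2.Hypotheses.localVHCAtCM_of_motivatedImpliesAlgebraicAV_of_deformation_of_catanese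
#print axioms Summit.HodgeConjecture.HodgeConjecture.Ring2.Hypotheses.hc_av_iff_motivatedImpliesAlgebraicAV_of_deformation_of_andre1996
#print axioms Summit.HodgeConjecture.HodgeConjecture.Ring2.Hypotheses.hodgeClasses_abelianVariety_motivated_of_hc_cm_of_cmAnchoredFamilies_of_deformation
#print axioms Summit.HodgeConjecture.HodgeConjecture.Ring2.Hypotheses.hc_av_of_hc_cm_of_cmAnchoredFamilies_of_motivatedImpliesAlgebraicAV_of_deformation

end Summit.HodgeConjecture.HodgeConjecture.Ring2.Hypotheses

end
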